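import Summits.ResolutionOfSingularities.ResolutionOfSingularities.Theorems.FrobeniusClosingSteerBetaNewtonStrictTransform
import HarnessLib

/-!
# Crux `Steer` (stmt-ResolutionOfSingularities-16345), chain W4.1, β-LEAF, K-β2♭ part (III), file G4: DOWNSTAIRS bookkeeping for the
# glue `yLetterLawHat_of` — the transform of a cleaning is a cleaning, the transform of a frame translation is a frame translation,
# and the cone clause moves along frame translations (def-free)

OURS (campaign `res-hironaka`, rung L ★L-G4, slot W4.1; statements about the route's own objects; they replace the
role of no printed item and are NOT statements of the manuscript under review [claim: Hironaka2017, status: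
under-review]; AI review is weaker than expert review). Seat res-D-pv-003 (gen 7), K-β2♭ owner; GLUE (III) per
res-L0-w41-plan-1 RULING 276(a).

* `pow_sub_pow_mem_mul_pow`, `eval_sub_eval_mem_mul_pow` — `Ψ(a) − Ψ(b) ∈ J·M^(d−1)` for a binary form `Ψ` of degree `d ≥ 1` when
  `aᵢ − bᵢ ∈ J` and `aᵢ, bᵢ ∈ M` (cone clause along a frame translation `z₁″ − z₁ ∈ (x₁, φ y)`).
* `pow_dvd_of_pow_dvd_sq` — `p^n ∣ s² ⇒ p^⌈n/2⌉ ∣ s` for a prime `p` of a domain.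
* `strictTransform_cleaning_eq` — along the `y`-chart letter the strict transform of `f + x^a y^b q²` is `f₁ + x₁^a (φ y)^b₁ q₁²`
  (`2k + b₁ = a + b + d`, `b₁ ≤ 1`): the transform of a cleaning is a cleaning with the downstairs twist.
* `exists_map_eq_mul_of_mem_maximalIdeal` — `φ(𝔪) ⊆ (φ y)`: the `y`-coefficient of an admissible frame change transforms to a
  multiple of `φ y`.

[cite: CossartJannsenSaito2020, Lemma 12.2] No Theses file is imported; nothing here is a route item or a registration.
-/

noncomputable section

-- `Summit.<S>.<S>.…` duplicates the summit name by design (single-problem summit).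
set_option linter.dupNamespace false

namespace Summit.ResolutionOfSingularities.ResolutionOfSingularities.Theorems.SwitchingDichotomy.BetaNewton

open IsLocalRing MvPolynomial
open Literature.AlgebraicGeometry.Resolution
open Summit.ResolutionOfSingularities.ResolutionOfSingularities.Theorems.SwitchingDichotomy.BetaPolygon
open Summit.ResolutionOfSingularities.ResolutionOfSingularities.Theorems.SwitchingDichotomy.BetaLetter (range_four)

variable {S S₁ : Type} [CommRing S] [CommRing S₁]

/-! ## §1 Binary forms along a translation -/

/-- `a − b ∈ J`, `a, b ∈ M` ⇒ `a^n − b^n ∈ J · M^(n−1)`. [folklore] -/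
theorem pow_sub_pow_mem_mul_pow {J M : Ideal S} {a b : S} (hab : a - b ∈ J) (ha : a ∈ M) (hb : b ∈ M) :
    ∀ n : ℕ, 1 ≤ n → a ^ n - b ^ n ∈ J * M ^ (n - 1)
  | 0, h => absurd h (by omega)
  | 1, _ => by simpa using hab
  | (n + 2), _ => by
    have ih := pow_sub_pow_mem_mul_pow hab ha hb (n + 1) (by omega)
    have : a ^ (n + 2) - b ^ (n + 2) = a * (a ^ (n + 1) - b ^ (n + 1)) + (a - b) * b ^ (n + 1) := by ring
    rw [this, show n + 2 - 1 = n + 1 from rfl]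
    refine add_mem ?_ (Ideal.mul_mem_mul hab (Ideal.pow_mem_pow hb _))
    have h1 : a * (a ^ (n + 1) - b ^ (n + 1)) ∈ M * (J * M ^ n) := Ideal.mul_mem_mul ha (by simpa using ih)
    have hle : M * (J * M ^ n) ≤ J * M ^ (n + 1) := by
      rw [← mul_assoc, mul_comm M J, mul_assoc, ← pow_succ']
    exact hle h1

/-- **A binary form of degree `d ≥ 1` along a translation**: `Ψ(a) − Ψ(b) ∈ J · M^(d−1)` when `aᵢ − bᵢ ∈ J` and `aᵢ, bᵢ ∈ M`.
[folklore] -/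
theorem eval_sub_eval_mem_mul_pow {Ψ : MvPolynomial (Fin 2) S} {d : ℕ} (hΨ : Ψ.IsHomogeneous d) (hd : 1 ≤ d)
    {J M : Ideal S} {a b : Fin 2 → S} (hab : ∀ i, a i - b i ∈ J) (ha : ∀ i, a i ∈ M) (hb : ∀ i, b i ∈ M) :
    eval a Ψ - eval b Ψ ∈ J * M ^ (d - 1) := by
  classical
  rw [Ψ.as_sum, map_sum, map_sum, ← Finset.sum_sub_distrib]
  refine Ideal.sum_mem _ fun m hm => ?_
  rw [eval_monomial, eval_monomial, ← mul_sub]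
  refine Ideal.mul_mem_left _ _ ?_
  have hdeg : m 0 + m 1 = d := by
    have h1 : m.degree = d := by
      have := hΨ (mem_support_iff.mp hm)
      rw [Finsupp.degree_eq_weight_one]; exact this
    rwa [Finsupp.degree_eq_sum, Fin.sum_univ_two] at h1
  rw [Finsupp.prod_fintype _ _ (by simp), Finsupp.prod_fintype _ _ (by simp), Fin.prod_univ_two, Fin.prod_univ_two]
  have : a 0 ^ m 0 * a 1 ^ m 1 - b 0 ^ m 0 * b 1 ^ m 1 =
      (a 0 ^ m 0 - b 0 ^ m 0) * a 1 ^ m 1 + b 0 ^ m 0 * (a 1 ^ m 1 - b 1 ^ m 1) := by ring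
  rw [this]
  refine add_mem ?_ ?_
  · rcases Nat.eq_zero_or_pos (m 0) with h0 | h0
    · rw [h0, pow_zero, pow_zero, sub_self, zero_mul]; exact Ideal.zero_mem _
    · have h1 := Ideal.mul_mem_mul (pow_sub_pow_mem_mul_pow (hab 0) (ha 0) (hb 0) (m 0) h0)
        (Ideal.pow_mem_pow (ha 1) (m 1))
      have hle : J * M ^ (m 0 - 1) * M ^ m 1 ≤ J * M ^ (d - 1) := by
        rw [mul_assoc, ← pow_add]
        exact Ideal.mul_mono_right (Ideal.pow_le_pow_right (by omega))
      exact hle h1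
  · rcases Nat.eq_zero_or_pos (m 1) with h1 | h1
    · rw [h1, pow_zero, pow_zero, sub_self, mul_zero]; exact Ideal.zero_mem _
    · have h2 := Ideal.mul_mem_mul (Ideal.pow_mem_pow (hb 0) (m 0))
        (pow_sub_pow_mem_mul_pow (hab 1) (ha 1) (hb 1) (m 1) h1)
      have hle : M ^ m 0 * (J * M ^ (m 1 - 1)) ≤ J * M ^ (d - 1) := by
        rw [← mul_assoc, mul_comm (M ^ m 0) J, mul_assoc, ← pow_add]
        exact Ideal.mul_mono_right (Ideal.pow_le_pow_right (by omega))
      exact hle h2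

/-! ## §2 Prime powers dividing a square -/

/-- **`p^n ∣ s² ⇒ p^⌈n/2⌉ ∣ s`** for a prime `p` of a domain. [folklore] -/
theorem pow_dvd_of_pow_dvd_sq [IsDomain S] {p : S} (hp : Prime p) :
    ∀ (n : ℕ) {s : S}, p ^ n ∣ s ^ 2 → p ^ ((n + 1) / 2) ∣ s
  | 0, s, _ => by simp
  | 1, s, h => by
    rw [pow_one] at h
    simpa using hp.dvd_of_dvd_pow h
  | (n + 2), s, h => by
    have h1 : p ∣ s := hp.dvd_of_dvd_pow (dvd_trans (dvd_pow_self p (by omega)) h)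
    obtain ⟨s₁, rfl⟩ := h1
    have h2 : p ^ n ∣ s₁ ^ 2 := by
      have : p ^ (n + 2) = p ^ 2 * p ^ n := by ring
      rw [this, mul_pow] at h
      exact (mul_dvd_mul_iff_left (pow_ne_zero 2 hp.ne_zero)).mp h
    have ih := pow_dvd_of_pow_dvd_sq hp n h2
    have : (n + 2 + 1) / 2 = (n + 1) / 2 + 1 := by omega
    rw [this, pow_succ']
    exact mul_dvd_mul_left p ih

/-! ## §3 The transform of a cleaning is a cleaning -/

/-- **Along the `y`-chart letter the strict transform of the cleaning `f + x^a y^b q²` is the cleaning `f₁ + x₁^a (φ y)^b₁ q₁²`**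
(`f₁ · (φ y)^d = φ f`, `g · (φ y)^d = φ (f + x^a y^b q²)`, `2k + b₁ = a + b + d`, `b₁ ≤ 1`, `a + b ≤ d`).
[cite: CossartJannsenSaito2020, Lemma 12.2] -/
theorem strictTransform_cleaning_eq [IsLocalRing S₁] (φ : S →+* S₁) {x y : S} {x₁ z₁ w₁ : S₁}
    (ht' : IsRsopPart ![x₁, φ y, z₁, w₁]) (hx : φ x = φ y * x₁) {d k a b b₁ : ℕ} (hk : 2 * k + b₁ = a + b + d)
    (hb₁ : b₁ ≤ 1) (hab : a + b ≤ d) {f q : S} {f₁ g : S₁} (hf : f₁ * φ y ^ d = φ f)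
    (hg : g * φ y ^ d = φ (f + x ^ a * y ^ b * q ^ 2)) :
    ∃ q₁ : S₁, g = f₁ + x₁ ^ a * φ y ^ b₁ * q₁ ^ 2 := by
  haveI := ht'.isRegularLocalRing
  haveI : IsDomain S₁ := isDomain_of_isRegularLocalRing S₁
  have hpy : Prime (φ y) := by simpa using ht'.prime 1
  have hxy : ¬ φ y ∣ x₁ := by simpa using ht'.not_dvd (i := 1) (j := 0) (by decide)
  have hy0 : φ y ≠ 0 := hpy.ne_zero
  -- `(φ y)^d (g − f₁) = x₁^a (φ y)^(a+b) (φ q)²`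
  have hmain : (g - f₁) * φ y ^ d = x₁ ^ a * φ y ^ (a + b) * φ q ^ 2 := by
    rw [sub_mul, hg, hf, map_add, map_mul, map_mul, map_pow, map_pow, map_pow, hx]; ring
  -- `(φ y)^(d − a − b) ∣ (φ q)²`
  set m : ℕ := d - (a + b) with hm
  have hdiv : φ y ^ m ∣ φ q ^ 2 := by
    have h1 : φ y ^ m ∣ x₁ ^ a * φ q ^ 2 := by
      have : φ y ^ (a + b) * (φ y ^ m * (g - f₁)) = φ y ^ (a + b) * (x₁ ^ a * φ q ^ 2) := by
        calc φ y ^ (a + b) * (φ y ^ m * (g - f₁)) = (g - f₁) * φ y ^ d := by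
              rw [hm, ← mul_assoc, ← pow_add, Nat.add_sub_cancel' hab]; ring
          _ = _ := by rw [hmain]; ring
      have := mul_left_cancel₀ (pow_ne_zero _ hy0) this
      exact ⟨g - f₁, by rw [← this]⟩
    exact (hpy.pow_dvd_of_dvd_mul_left m (fun h => hxy (hpy.dvd_of_dvd_pow h)) h1)
  obtain ⟨r, hr⟩ := pow_dvd_of_pow_dvd_sq hpy m hdiv
  -- the exponent bookkeeping
  have hpar : a + b + 2 * ((m + 1) / 2) - d = b₁ := by omega
  refine ⟨r, ?_⟩
  have : (g - f₁) * φ y ^ d = (x₁ ^ a * φ y ^ b₁ * r ^ 2) * φ y ^ d := by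
    rw [hmain, hr, ← hpar]
    have hle : d ≤ a + b + 2 * ((m + 1) / 2) := by omega
    obtain ⟨e, he⟩ := Nat.exists_eq_add_of_le hle
    rw [he, Nat.add_sub_cancel_left]
    have : a + b + 2 * ((m + 1) / 2) = d + e := he
    calc x₁ ^ a * φ y ^ (a + b) * (φ y ^ ((m + 1) / 2) * r) ^ 2
        = x₁ ^ a * r ^ 2 * φ y ^ (a + b + 2 * ((m + 1) / 2)) := by ring
      _ = x₁ ^ a * r ^ 2 * φ y ^ (d + e) := by rw [this]
      _ = x₁ ^ a * φ y ^ e * r ^ 2 * φ y ^ d := by ring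
  have := mul_right_cancel₀ (pow_ne_zero d hy0) this
  rw [← this]; ring

/-! ## §4 The transform of an admissible frame change -/

/-- **`φ(𝔪) ⊆ (φ y)` along the `y`-chart letter**: for `c ∈ 𝔪 = (x, y, z, w)` there is `e` with `φ c = φ y · e`. [folklore] -/
theorem exists_map_eq_mul_of_mem_maximalIdeal [IsLocalRing S] (φ : S →+* S₁) {x y z w : S} {x₁ z₁ w₁ : S₁}
    (hspan : Ideal.span {x, y, z, w} = maximalIdeal S) (hx : φ x = φ y * x₁) (hz : φ z = φ y * z₁)
    (hw : φ w = φ y * w₁) {c : S} (hc : c ∈ maximalIdeal S) : ∃ e : S₁, φ c = φ y * e := by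
  rw [← hspan, ← range_four] at hc
  obtain ⟨γ, rfl⟩ := Ideal.mem_span_range_iff_exists_fun.mp hc
  refine ⟨φ (γ 0) * x₁ + φ (γ 1) + φ (γ 2) * z₁ + φ (γ 3) * w₁, ?_⟩
  rw [map_sum, Fin.sum_univ_four]
  simp only [map_mul, Matrix.cons_val_zero, Matrix.cons_val_one, Matrix.cons_val, hx, hz, hw]
  ring

end Summit.ResolutionOfSingularities.ResolutionOfSingularities.Theorems.SwitchingDichotomy.BetaNewton

end
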